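/-
Origin: expansion seat `planner-pub-hodgecm-qw8-g7-0`, handover #1 2026-08-18T09:36:16Z (`HOME/pub-hodgecm-qw8-g7/lean/Qw8g7/LefDegree4.lean`, md5 1cc78409, 231 lines);
landed by the gen-7 packager in gate run 27 as `HodgeCM/Model/Toy/LefDegree4.lean` (import ^import Qw8g6\.→import HodgeCM.Model.Toy. ×1).
-/
-- HANDOVER (planner-pub-hodgecm-qw8-g7-0, unit pub-hodgecm-qw8-g7): WIP module `Qw8g7.LefDegree4`; intended final
-- module `HodgeCM.Model.Toy.LefDegree4` (kind L5, separating model — sharpness); rename `import Qw8g6.X` ↦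
-- `import HodgeCM.Model.Toy.X`.
/-
Copyright: pub-hodgecm cell (HodgeCMPerL). Separating-model layer (gen 7 of the [QW8] §2.5 lineage). New file.
-/
import Mathlib
import Summits.HodgeConjecture.HodgeCM.Model.Toy.LefWitness

/-!
# The Lefschetz model in degree four: the separation is sharp

`HodgeCM.Model.Toy.LefWitness` proved that in the Lefschetz model `lefModel` (exterior CM-model with
`Alg := Hdg ∩ Bal`) the Weil line of a face of a CM field of degree `> 4` is NOT algebraic
(`not_weilFaceAlgebraic_lefModel`), because no corner of such a face is the conjugate type `Φ̄` of the first
(`corner_ne_compl`), so every eigen-index map `r σ` of a Weil generator is unbalanced.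

Here we prove the complementary statement, showing that the hypothesis `4 < [K:ℚ]` of the separation is
SHARP and that the obstruction is exactly the corner asymmetry of genuine faces:

* `mem_placeSet_or_of_finrank_eq_four` — for a QUARTIC CM field the two places `π ≠ π'` of a face exhaust
  the complex embeddings (`{p, p̄, p', p̄'}` are four distinct embeddings: no embedding of a field carrying a
  CM type is real, and the two places are distinct); in particular every face lives in degree `≥ 4`
  (`four_le_finrank_of_face`);
* hence the four corners pair into complements, `Φ₄ = Φ̄₁` and `Φ₃ = Φ̄₂`
  (`corner_three_eq_compl`, `corner_two_eq_compl`; indices `corner 3 = (corner 0)ᶜ`, `corner 2 = (corner 1)ᶜ`);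
* so the Galois types along every index map `r σ = ((0,σ),(1,σ),(2,σ),(3,σ))` pair off under `j ↦ 3 - j`
  into complements and `r σ` is BALANCED (`Obj.bal_of_typ_rev`, `bal_r_of_compl`), whence the whole Weil
  line is balanced, `W_K(P) ≤ Bal⁴(P)` (`weilLine_le_balQ_of_bal`), and — the Weil line consisting of Hodge
  classes (M16, `fact_weilLine_hodge`) — it IS `lefModel`-algebraic (`lef_weilFaceAlgebraic_of_finrank_eq_four`).

HEADLINE `lef_weilFaceAlgebraic_iff_finrank_eq_four`: in the Lefschetz model the Weil line of a face
`(Φ; π, π')` of a CM field `K` is algebraic IF AND ONLY IF `[K:ℚ] = 4`.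
Nothing here is cited: kernel facts about an explicit model.
-/

noncomputable section

set_option backward.isDefEq.respectTransparency false

namespace HodgeCM.Toy

open scoped TensorProduct
open exteriorPower Module CMPresentation CMTypeOps
open NumberField.ComplexEmbedding (conjugate)
open Literature.AlgebraicGeometry.Motives
open Literature.AlgebraicGeometry.Motives.HodgeStructure (ofRat ofRat_apply mem_hodgeClasses_iff)

/-! ### 1. Faces of a quartic CM field: the two places exhaust the embeddings -/

section Quartic

variable {K : Type} [Field K]

/-- no complex embedding of a field carrying a CM type is real -/
theorem conjugate_ne_self_of_cmType (Φ : CMType K) (ψ : K →+* ℂ) : conjugate ψ ≠ ψ := fun h => by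
  have k := mem_iff_conjugate_notMem Φ ψ
  rw [h] at k
  exact iff_not_self k

open scoped Classical in
/-- the four embeddings `p, p̄, p', p̄'` over the two places of a face are distinct -/
theorem card_placeFinset (f : Face K) :
    ({f.p, conjugate f.p, f.p', conjugate f.p'} : Finset (K →+* ℂ)).card = 4 := by
  have hne := conjugate_ne_self_of_cmType f.Φ
  have hp : f.p ∈ placeSet f.p := Set.mem_insert _ _
  have hpc : conjugate f.p ∈ placeSet f.p := Set.mem_insert_of_mem _ (Set.mem_singleton _)
  have hp' : f.p' ∈ placeSet f.p' := Set.mem_insert _ _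
  have hpc' : conjugate f.p' ∈ placeSet f.p' := Set.mem_insert_of_mem _ (Set.mem_singleton _)
  have h1 : f.p ∉ ({conjugate f.p, f.p', conjugate f.p'} : Finset (K →+* ℂ)) := by
    simp only [Finset.mem_insert, Finset.mem_singleton, not_or]
    exact ⟨(hne f.p).symm, fun h => f.not_mem_both hp (by rw [h]; exact hp'),
      fun h => f.not_mem_both hp (by rw [h]; exact hpc')⟩
  have h2 : conjugate f.p ∉ ({f.p', conjugate f.p'} : Finset (K →+* ℂ)) := by
    simp only [Finset.mem_insert, Finset.mem_singleton, not_or]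
    exact ⟨fun h => f.not_mem_both hpc (by rw [h]; exact hp'),
      fun h => f.not_mem_both hpc (by rw [h]; exact hpc')⟩
  have h3 : f.p' ∉ ({conjugate f.p'} : Finset (K →+* ℂ)) := by
    rw [Finset.mem_singleton]; exact (hne f.p').symm
  rw [Finset.card_insert_of_notMem h1, Finset.card_insert_of_notMem h2, Finset.card_insert_of_notMem h3,
    Finset.card_singleton]

variable [NumberField K]

/-- every face of a CM field lives in degree `≥ 4` -/
theorem four_le_finrank_of_face (f : Face K) : 4 ≤ Module.finrank ℚ K := by
  classical
  rw [← NumberField.Embeddings.card K ℂ, ← card_placeFinset f]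
  exact Finset.card_le_univ _

/-- **quartic faces**: if `[K:ℚ] = 4`, every complex embedding lies over one of the two places of the face -/
theorem mem_placeSet_or_of_finrank_eq_four (f : Face K) (h4 : Module.finrank ℚ K = 4) (φ : K →+* ℂ) :
    φ ∈ placeSet f.p ∨ φ ∈ placeSet f.p' := by
  classical
  have huniv : ({f.p, conjugate f.p, f.p', conjugate f.p'} : Finset (K →+* ℂ)) = Finset.univ :=
    Finset.eq_univ_of_card _ (by rw [card_placeFinset f, NumberField.Embeddings.card K ℂ, h4])
  have hφ := Finset.mem_univ φ
  rw [← huniv] at hφ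
  simp only [Finset.mem_insert, Finset.mem_singleton] at hφ
  rcases hφ with h | h | h | h <;> subst h
  · exact Or.inl (Set.mem_insert _ _)
  · exact Or.inl (Set.mem_insert_of_mem _ (Set.mem_singleton _))
  · exact Or.inr (Set.mem_insert _ _)
  · exact Or.inr (Set.mem_insert_of_mem _ (Set.mem_singleton _))

/-- **corner pairing in degree four, I**: `Φ₄ = Φ^{(ππ')}` IS the conjugate type `Φ̄₁` (cf.
`corner_ne_compl`: in degree `> 4` it never is) -/
theorem corner_three_eq_compl (f : Face K) (h4 : Module.finrank ℚ K = 4) :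
    (f.corner 3).1 = ((f.corner 0).1)ᶜ := by
  ext φ
  rcases mem_placeSet_or_of_finrank_eq_four f h4 φ with h | h
  · have h' : φ ∉ placeSet f.p' := fun h' => f.not_mem_both h h'
    simp only [Face.corner, Set.mem_compl_iff, mem_flip_iff]
    tauto
  · have h' : φ ∉ placeSet f.p := fun h' => f.not_mem_both h' h
    simp only [Face.corner, Set.mem_compl_iff, mem_flip_iff]
    tauto

/-- **corner pairing in degree four, II**: `Φ₃ = Φ̄^{(π')}` is the conjugate type of `Φ₂ = Φ̄^{(π)}` -/
theorem corner_two_eq_compl (f : Face K) (h4 : Module.finrank ℚ K = 4) :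
    (f.corner 2).1 = ((f.corner 1).1)ᶜ := by
  ext φ
  rcases mem_placeSet_or_of_finrank_eq_four f h4 φ with h | h
  · have h' : φ ∉ placeSet f.p' := fun h' => f.not_mem_both h h'
    simp only [Face.corner, Set.mem_compl_iff, mem_flip_iff, mem_bar_iff]
    tauto
  · have h' : φ ∉ placeSet f.p := fun h' => f.not_mem_both h' h
    simp only [Face.corner, Set.mem_compl_iff, mem_flip_iff, mem_bar_iff]
    tauto

end Quartic

/-! ### 2. Index maps whose Galois types pair into complements are balanced -/

/-- if the Galois types along `g : Fin k → Idx` pair off under `j ↦ k-1-j` into complements, `g` is balanced: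
`j ↦ k-1-j` is a bijection `{j | typ (g j) = T} ≃ {j | typ (g j) = Tᶜ}` -/
theorem Obj.bal_of_typ_rev (X : Obj) {k : ℕ} (g : Fin k → X.Idx)
    (h : ∀ j : Fin k, X.typ (g (Fin.rev j)) = (X.typ (g j))ᶜ) : X.Bal g := by
  classical
  intro T
  rw [X.tcnt_eq_card_filter, X.tcnt_eq_card_filter]
  exact Finset.card_equiv Fin.revPerm fun j => by
    simp only [Finset.mem_filter, Finset.mem_univ, true_and, Fin.revPerm_apply, h j, compl_inj_iff]

section Corner

variable {K : CMField} {Φ : Fin 4 → CMType K}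

/-- complementary corner types give complementary Galois types along `r σ` (`typ_r`) -/
theorem typ_r_of_eq_compl (σ : K →+* ℂ) {i j : Fin 4} (h : (Φ i).1 = ((Φ j).1)ᶜ) :
    (PP K Φ).typ (r K Φ σ i) = ((PP K Φ).typ (r K Φ σ j))ᶜ := by
  rw [typ_r, typ_r, h]
  ext γ
  simp only [Set.mem_setOf_eq, Set.mem_compl_iff]

/-- **balancedness**: if the corners pair into complements, `Φ₃ = Φ̄₀` and `Φ₂ = Φ̄₁` (indices `0 … 3`),
every index map `r σ` of a Weil generator is balanced -/
theorem bal_r_of_compl (h30 : (Φ 3).1 = ((Φ 0).1)ᶜ) (h21 : (Φ 2).1 = ((Φ 1).1)ᶜ)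
    (σ : K →+* ℂ) : (PP K Φ).Bal (r K Φ σ) := by
  refine (PP K Φ).bal_of_typ_rev (r K Φ σ) fun j => ?_
  match j with
  | 0 => exact typ_r_of_eq_compl σ h30
  | 1 => exact typ_r_of_eq_compl σ h21
  | 2 => exact eq_compl_comm.mp (typ_r_of_eq_compl σ h21)
  | 3 => exact eq_compl_comm.mp (typ_r_of_eq_compl σ h30)

end Corner

/-- for a face of a QUARTIC CM field every index map `r σ` of the corner product is balanced -/
theorem bal_r_face_of_finrank_eq_four (K : CMField) (f : Face K) (h4 : Module.finrank ℚ K = 4)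
    (σ : K →+* ℂ) : (PP K f.corner).Bal (r K f.corner σ) :=
  bal_r_of_compl (corner_three_eq_compl f h4) (corner_two_eq_compl f h4) σ

/-! ### 3. A Weil line with balanced generators is balanced -/

section Balanced

variable (D : HodgeData) (K : CMField) (Φ : Fin 4 → CMType K)

/-- **`W_K(P) ≤ Bal⁴(P)`** when every `r σ` is balanced: `W ⊗ ℂ` is spanned by the `g_σ` and
`Θ g_σ = e_{r σ} ∈ balSpan` (`theta_g`). -/
theorem weilLine_le_balQ_of_bal (hbal : ∀ σ : K →+* ℂ, (PP K Φ).Bal (r K Φ σ)) :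
    (toyModelWith D).weilLine K Φ ≤ (PP K Φ).balQ 4 := by
  intro x hx
  rw [Obj.mem_balQ]
  have hx1 : (ofRat x : (toyModelWith D).CohC ((toyModelWith D).prod4 K Φ) 4) ∈
      Submodule.span ℂ ((toyModelWith D).weilGenerators K Φ) := hx
  have hx2 : (ofRat x : (toyModelWith D).CohC ((toyModelWith D).prod4 K Φ) 4) ∈
      Submodule.span ℂ (Set.range (g D K Φ)) :=
    Submodule.span_le.mpr (weilGenerators_subset_span_g D K Φ) hx1
  have hle : Submodule.span ℂ (Set.range (g D K Φ)) ≤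
      ((PP K Φ).balSpan 4).comap ((PP K Φ).Θ 4).toLinearMap := by
    rw [Submodule.span_le]
    rintro _ ⟨σ, rfl⟩
    show (PP K Φ).Θ 4 (g D K Φ σ) ∈ (PP K Φ).balSpan 4
    rw [theta_g]
    exact (PP K Φ).mono_mem_balSpan (hbal σ)
  exact hle hx2

end Balanced

/-- the Weil line of a face of a quartic CM field is balanced -/
theorem weilLine_face_le_balQ_of_finrank_eq_four (D : HodgeData) (K : CMField) (f : Face K)
    (h4 : Module.finrank ℚ K = 4) : (toyModelWith D).weilLine K f.corner ≤ (PP K f.corner).balQ 4 :=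
  weilLine_le_balQ_of_bal D K f.corner (bal_r_face_of_finrank_eq_four K f h4)

/-! ### 4. Sharpness of the separation -/

/-- **degree four**: the Weil line of a face of a QUARTIC CM field IS `lefModel`-algebraic (it consists of Hodge
classes by M16 and of balanced classes by §3). -/
theorem lef_weilFaceAlgebraic_of_finrank_eq_four (K : CMField) (f : Face K) (h4 : Module.finrank ℚ K = 4) :
    lefModel.WeilFaceAlgebraic K f := by
  rw [lefModel_eq, Universe.balMod_weilFaceAlgebraic_iff]
  intro x hx
  refine Submodule.mem_inf.mpr ⟨fact_weilLine_hodge exteriorHodgeData K f hx, ?_⟩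
  change x ∈ (PP K f.corner).balQ 4
  exact weilLine_face_le_balQ_of_finrank_eq_four exteriorHodgeData K f h4 hx

/-- **HEADLINE (sharpness of the separation).** In the Lefschetz model the Weil line of a face `(Φ; π, π')` of a
CM field `K` is algebraic if and only if `[K:ℚ] = 4`: `not_weilFaceAlgebraic_lefModel` (degree `> 4`, genuine
faces) and `lef_weilFaceAlgebraic_of_finrank_eq_four` (degree `4`, corners pair into complements) are
complementary, every face living in degree `≥ 4`. -/
theorem lef_weilFaceAlgebraic_iff_finrank_eq_four (K : CMField) (f : Face K) :
    lefModel.WeilFaceAlgebraic K f ↔ Module.finrank ℚ K = 4 := by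
  refine ⟨fun h => ?_, lef_weilFaceAlgebraic_of_finrank_eq_four K f⟩
  by_contra h4
  exact not_weilFaceAlgebraic_lefModel K f (lt_of_le_of_ne (four_le_finrank_of_face f) (Ne.symm h4)) h

end HodgeCM.Toy

end
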